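import Literature.NumberTheory.PAdicHodge.BmaxPlusKerTheta
import Literature.NumberTheory.PAdicHodge.BdRPlusLatticeComplete
import Literature.NumberTheory.PAdicHodge.BdRPlusLog
import HarnessLib

/-!
# The comparison `B_max⁺(F) → B_dR⁺(F)/Fil^k`: the `p`-adic completion of `𝔸_inf[ξ/p]` maps to `B_dR⁺` modulo every `ξ^k`

Topic `Literature/NumberTheory/PAdicHodge`; namespace `Literature.NumberTheory.PAdicHodge`. THEOREMS ONLY (no definition, no named
fact, no instance, no `sorry`). `B⁰_max = 𝔸_inf[ξ/p]` (`bmaxZero`) is a subring of `𝔸_inf[1/p]`, which maps to Fontaine's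
`B_dR⁺ = (𝔸_inf[1/p])^_{ker θ}`; write `ι₀ : B⁰_max → B_dR⁺` for this map (displayed as `algebraMap (𝔸_inf[1/p]) B_dR⁺ ↑y`, def-free).
`ι₀` is NOT continuous for the `p`-adic topology of `B⁰_max` and the `ξ`-adic topology of `B_dR⁺` (`p` is a unit of `B_dR⁺`), but it
is for Fontaine's lattice topology `Λ(N, k) = p^N ι(𝔸_inf) + ξ^k B_dR⁺` on `B_dR⁺/Fil^k` (tree `BdRPlusGaloisContinuity`,
`BdRPlusLatticeSeparated`, `BdRPlusLatticeComplete`), UNIFORMLY: `p^k ι₀(B⁰_max) ⊆ ι(𝔸_inf) + ξ^k B_dR⁺`. Hence Colmez's comparison map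
`B_max⁺ → B_dR⁺` (injective; Colmez 1998 §III.2) exists modulo every `Fil^k`:

* ★ `exists_natCast_pow_mul_eq_algebraMap_add_xi_pow_mul` — **uniform denominators**: for `y ∈ B⁰_max` and `k`,
  `p^k y = a + ξ^k z` with `a ∈ 𝔸_inf`, `z ∈ B⁰_max` (`y = q(ξ/p)`, split `q` at degree `k`);
* `exists_natCast_pow_mul_algebraMap_coe_eq` — the lattice form `p^k ι₀(y) ∈ ι(𝔸_inf) + ξ^k B_dR⁺`, and
  `exists_natCast_pow_mul_algebraMap_coe_eq_of_mem_pow` — `y ∈ p^N B⁰_max ⇒ p^k ι₀(y) ∈ Λ(N, k)`;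
* ★★ `exists_bdR_lim_modFil` — **the comparison modulo `Fil^k`**: for `x ∈ B_max⁺` and `k` there are `L ∈ B_dR⁺` and a shift `r`
  such that for all level representatives `y` of `x` modulo `p^M` (`M ≥ N + r`), `p^k (L − ι₀ y) ∈ Λ(N, k)`: `ι₀(x mod p^M) → L`
  modulo `Fil^k`; ★ `sub_mem_span_xiBdR_pow_of_bdR_lim_modFil` — `L` is unique modulo `ξ^k B_dR⁺`;
  `bdR_lim_modFil_of_le` — a level-`k'` limit is a level-`k` limit for `k ≤ k'`;
* (sequel `BmaxPlusBdRModFilRing`: on `B⁰_max` / `𝔸_inf` one may take `L = ι₀(y)` / `ι(a)`; limits add and multiply, so that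
  `x ↦ L mod ξ^k` is a ring homomorphism `B_max⁺ → B_dR⁺/Fil^k`, compatible in `k`.)

Brick B5 (first half: existence, uniqueness and ring structure of the comparison modulo `Fil^k`; the identification of the images of
`log[x]` and of the formal-group periods with the tree's `IsTeichLog` / `IsFormalLogModFil` values is the second half) of the φ-road of
line `kato_lever` (crux K★ `stmt-BirchSwinnertonDyer-22226`, memo `Cruxes/StarredOptimalManinUnitFiveSeven/Lines/kato-lever-K2-phi-road.md`
§1); the statement (K₂) there is a congruence modulo `Fil²`. Infrastructure only: BSD / K★ are not proved by any of this.

## References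
* [Colmez1998Annals] P. Colmez, *Théorie d'Iwasawa des représentations de de Rham d'un corps local*, Ann. of Math. 148 (1998), §III.2
  (`B_max⁺ ⊂ B_dR⁺`).
* [FontaineAsterisque223III] J.-M. Fontaine, *Le corps des périodes p-adiques*, Astérisque 223 (1994), Exp. II §1.5.3, §2.3.
* [BergerLaurent2002] L. Berger, *Représentations p-adiques et équations différentielles*, Invent. Math. 148 (2002), §1.2.
-/

noncomputable section

open WittVector Field ValuativeRel Polynomial Finset
open Literature.AlgebraicGeometry.Resolution

namespace Literature.NumberTheory.PAdicHodge

open Literature.NumberTheory.GaloisRepresentations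
open Literature.NumberTheory.GaloisRepresentations.IsNonarchimedeanLocalField

variable {F : Type} [Field F] [ValuativeRel F] [TopologicalSpace F] [IsNonarchimedeanLocalField F]
  [CharZero F] {p : ℕ} [Fact p.Prime] [Fact (¬ IsUnit (p : integerC F))]
  [IsAdicComplete (Ideal.span {(p : integerC F)}) (integerC F)]

/-! ### §1 Uniform denominators in `B⁰_max = 𝔸_inf[ξ/p]` -/

omit [CharZero F] [IsAdicComplete (Ideal.span {(p : integerC F)}) (integerC F)] in
/-- `p^k · ω^k · z = ξ^k · z` in `B⁰_max` (`ω = ξ/p`). [cite: BergerLaurent2002, §1.2] -/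
theorem natCast_pow_mul_omegaB_pow_mul (k : ℕ) (z : bmaxZero F p) :
    (p : bmaxZero F p) ^ k * (omegaB ^ k * z) = algebraMap (Ainf (p := p) F) (bmaxZero F p) (xi ^ k) * z := by
  rw [← mul_assoc, ← mul_pow, natCast_mul_omegaB, map_pow]

omit [CharZero F] [IsAdicComplete (Ideal.span {(p : integerC F)}) (integerC F)] in
/-- ★ **Uniform denominators**: every `y ∈ B⁰_max = 𝔸_inf[ξ/p]` satisfies `p^k y = a + ξ^k z` with `a ∈ 𝔸_inf` and `z ∈ B⁰_max`
(write `y = q(ξ/p)` and split `q = X^k q₁ + q₀`, `deg q₀ < k`: `p^k q₀(ξ/p) ∈ 𝔸_inf`, `p^k (ξ/p)^k = ξ^k`).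
[cite: Colmez1998Annals, §III.2] [cite: BergerLaurent2002, §1.2] -/
theorem exists_natCast_pow_mul_eq_algebraMap_add_xi_pow_mul (y : bmaxZero F p) (k : ℕ) :
    ∃ (a : Ainf (p := p) F) (z : bmaxZero F p),
      (p : bmaxZero F p) ^ k * y = algebraMap (Ainf (p := p) F) (bmaxZero F p) a +
        algebraMap (Ainf (p := p) F) (bmaxZero F p) (xi ^ k) * z := by
  obtain ⟨q, rfl⟩ := exists_aeval_omegaB_eq y
  -- split `q` at degree `k`
  have hmonic : (X ^ k : (Ainf (p := p) F)[X]).Monic := monic_X_pow k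
  have hsplit : q = X ^ k * (q /ₘ X ^ k) + q %ₘ X ^ k := (modByMonic_add_div q (X ^ k)).symm.trans (by ring)
  have hdeg : (q %ₘ X ^ k).natDegree ≤ k := (natDegree_modByMonic_le q hmonic).trans (natDegree_X_pow k).le
  refine ⟨∑ j ∈ range (k + 1), (q %ₘ X ^ k).coeff j * (p : Ainf (p := p) F) ^ (k - j) * xi ^ j, aeval omegaB (q /ₘ X ^ k), ?_⟩
  conv_lhs => rw [hsplit]
  rw [map_add, mul_add, ← natCast_pow_mul_aeval_omegaB hdeg, map_mul, map_pow, aeval_X, natCast_pow_mul_omegaB_pow_mul, add_comm]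

/-! ### §2 The lattice form in `B_dR⁺`: `p^k ι₀(B⁰_max) ⊆ ι(𝔸_inf) + ξ^k B_dR⁺` -/

omit [CharZero F] in
/-- `ι₀ ∘ (𝔸_inf → B⁰_max) = ι : 𝔸_inf → B_dR⁺`. [folklore: unfolding of the structure maps] -/
private theorem algebraMap_coe_algebraMap (a : Ainf (p := p) F) :
    algebraMap (Localization.Away (p : Ainf (p := p) F)) (BDeRhamPlus (integerC F) p)
        ((algebraMap (Ainf (p := p) F) (bmaxZero F p) a : bmaxZero F p) : Localization.Away (p : Ainf (p := p) F)) =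
      ainfToBdR a := rfl

omit [CharZero F] in
/-- `ι₀` as the ring map `(𝔸_inf[1/p] → B_dR⁺) ∘ val`. [folklore: unfolding] -/
private theorem comp_val_apply (y : bmaxZero F p) :
    ((algebraMap (Localization.Away (p : Ainf (p := p) F)) (BDeRhamPlus (integerC F) p)).comp (bmaxZero F p).val.toRingHom) y =
      algebraMap (Localization.Away (p : Ainf (p := p) F)) (BDeRhamPlus (integerC F) p) (y : Localization.Away (p : Ainf (p := p) F)) := rfl

omit [CharZero F] in
/-- **`p^k ι₀(y) ∈ ι(𝔸_inf) + ξ^k B_dR⁺` for every `y ∈ B⁰_max`** (lattice `Λ(0, k)` after the uniform denominator `p^k`).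
[cite: Colmez1998Annals, §III.2] -/
theorem exists_natCast_pow_mul_algebraMap_coe_eq (y : bmaxZero F p) (k : ℕ) :
    ∃ (a : Ainf (p := p) F) (w : BDeRhamPlus (integerC F) p),
      (p : BDeRhamPlus (integerC F) p) ^ k *
          algebraMap (Localization.Away (p : Ainf (p := p) F)) (BDeRhamPlus (integerC F) p) (y : Localization.Away (p : Ainf (p := p) F)) =
        ainfToBdR a + xiBdR ^ k * w := by
  obtain ⟨a, z, h⟩ := exists_natCast_pow_mul_eq_algebraMap_add_xi_pow_mul y k
  refine ⟨a, algebraMap (Localization.Away (p : Ainf (p := p) F)) (BDeRhamPlus (integerC F) p) (z : Localization.Away (p : Ainf (p := p) F)), ?_⟩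
  have h1 := congrArg ((algebraMap (Localization.Away (p : Ainf (p := p) F)) (BDeRhamPlus (integerC F) p)).comp (bmaxZero F p).val.toRingHom) h
  simp only [map_mul, map_add, map_pow, map_natCast, comp_val_apply] at h1
  rw [h1, algebraMap_coe_algebraMap, algebraMap_coe_algebraMap, ainfToBdR_xi]

omit [CharZero F] in
/-- **`y ∈ p^N B⁰_max ⇒ p^k ι₀(y) ∈ Λ(N, k) = p^N ι(𝔸_inf) + ξ^k B_dR⁺`.** [cite: Colmez1998Annals, §III.2]
[cite: FontaineAsterisque223III, Exp. II §1.5.3] -/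
theorem exists_natCast_pow_mul_algebraMap_coe_eq_of_mem_pow {y : bmaxZero F p} {N : ℕ}
    (hy : y ∈ Ideal.span {(p : bmaxZero F p)} ^ N) (k : ℕ) :
    ∃ (a : Ainf (p := p) F) (w : BDeRhamPlus (integerC F) p),
      (p : BDeRhamPlus (integerC F) p) ^ k *
          algebraMap (Localization.Away (p : Ainf (p := p) F)) (BDeRhamPlus (integerC F) p) (y : Localization.Away (p : Ainf (p := p) F)) =
        ainfToBdR ((p : Ainf (p := p) F) ^ N * a) + xiBdR ^ k * w := by
  rw [Ideal.span_singleton_pow, Ideal.mem_span_singleton'] at hy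
  obtain ⟨y', rfl⟩ := hy
  obtain ⟨a, w, h⟩ := exists_natCast_pow_mul_algebraMap_coe_eq y' k
  refine ⟨a, (p : BDeRhamPlus (integerC F) p) ^ N * w, ?_⟩
  have e1 : algebraMap (Localization.Away (p : Ainf (p := p) F)) (BDeRhamPlus (integerC F) p)
      ((y' * (p : bmaxZero F p) ^ N : bmaxZero F p) : Localization.Away (p : Ainf (p := p) F)) =
      algebraMap (Localization.Away (p : Ainf (p := p) F)) (BDeRhamPlus (integerC F) p) (y' : Localization.Away (p : Ainf (p := p) F)) *
        (p : BDeRhamPlus (integerC F) p) ^ N := by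
    rw [← comp_val_apply, map_mul, map_pow, map_natCast, comp_val_apply]
  rw [e1, map_mul, map_pow, map_natCast]
  linear_combination ((p : BDeRhamPlus (integerC F) p) ^ N) * h

/-! ### §3 The comparison `B_max⁺ → B_dR⁺/Fil^k` -/

set_option maxHeartbeats 1600000 in
omit [CharZero F] [IsAdicComplete (Ideal.span {(p : integerC F)}) (integerC F)] in
/-- Two representatives of `x mod p^M` differ by an element of `p^M B⁰_max`; representatives at levels `M ≤ M'` are congruent
modulo `p^M` (`B_max⁺` is the `p`-adic completion of `B⁰_max`). [cite: BergerLaurent2002, §1.2] -/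
theorem sub_mem_pow_of_evalₐ_eq {x : BmaxPlus F p} {M M' : ℕ} (hMM' : M ≤ M') {y y' : bmaxZero F p}
    (hy : AdicCompletion.evalₐ (Ideal.span {(p : bmaxZero F p)}) M x = Ideal.Quotient.mk _ y)
    (hy' : AdicCompletion.evalₐ (Ideal.span {(p : bmaxZero F p)}) M' x = Ideal.Quotient.mk _ y') :
    y' - y ∈ Ideal.span {(p : bmaxZero F p)} ^ M := by
  have h := factorPow_evalₐ (Ideal.span {(p : bmaxZero F p)}) hMM' x
  rw [hy', Ideal.Quotient.factorPow, Ideal.Quotient.factor_mk, hy] at h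
  exact (Ideal.Quotient.eq).1 h

set_option maxHeartbeats 3200000 in
/-- ★★ **The comparison `B_max⁺ → B_dR⁺` modulo `Fil^k`.** For every `x ∈ B_max⁺(F)` and every `k` there are `L ∈ B_dR⁺` and a
shift `r` such that for all `N`, all `M ≥ N + r` and EVERY representative `y ∈ B⁰_max` of `x mod p^M`,
`p^k (L − ι₀(y)) ∈ Λ(N, k) = p^N ι(𝔸_inf) + ξ^k B_dR⁺`: the images of the `p`-adic approximations of `x` converge to `L` modulo `Fil^k`
for Fontaine's topology (`BdRPlusLatticeComplete`). [cite: Colmez1998Annals, §III.2] [cite: FontaineAsterisque223III, Exp. II §1.5.3] -/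
theorem exists_bdR_lim_modFil (x : BmaxPlus F p) (k : ℕ) :
    ∃ (L : BDeRhamPlus (integerC F) p) (r : ℕ), ∀ N M : ℕ, N + r ≤ M → ∀ y : bmaxZero F p,
      AdicCompletion.evalₐ (Ideal.span {(p : bmaxZero F p)}) M x = Ideal.Quotient.mk _ y →
      ∃ (a : Ainf (p := p) F) (w : BDeRhamPlus (integerC F) p),
        (p : BDeRhamPlus (integerC F) p) ^ k *
            (L - algebraMap (Localization.Away (p : Ainf (p := p) F)) (BDeRhamPlus (integerC F) p)
              (y : Localization.Away (p : Ainf (p := p) F))) =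
          ainfToBdR ((p : Ainf (p := p) F) ^ N * a) + xiBdR ^ k * w := by
  -- chosen representatives
  choose y₀ hy₀ using fun M => Ideal.Quotient.mk_surjective (AdicCompletion.evalₐ (Ideal.span {(p : bmaxZero F p)}) M x)
  -- the sequence `p^k ι₀(y₀ M)` is lattice-Cauchy
  have hcauchy : ∀ M, ∃ (a : Ainf (p := p) F) (w : BDeRhamPlus (integerC F) p),
      (p : BDeRhamPlus (integerC F) p) ^ k *
          algebraMap (Localization.Away (p : Ainf (p := p) F)) (BDeRhamPlus (integerC F) p)
            (y₀ (M + 1) : Localization.Away (p : Ainf (p := p) F)) -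
        (p : BDeRhamPlus (integerC F) p) ^ k *
          algebraMap (Localization.Away (p : Ainf (p := p) F)) (BDeRhamPlus (integerC F) p)
            (y₀ M : Localization.Away (p : Ainf (p := p) F)) =
        ainfToBdR ((p : Ainf (p := p) F) ^ M * a) + xiBdR ^ k * w := by
    intro M
    obtain ⟨a, w, h⟩ := exists_natCast_pow_mul_algebraMap_coe_eq_of_mem_pow
      (sub_mem_pow_of_evalₐ_eq (Nat.le_succ M) (hy₀ M).symm (hy₀ (M + 1)).symm) k
    refine ⟨a, w, ?_⟩
    rw [← mul_sub, ← comp_val_apply, ← comp_val_apply, ← map_sub, comp_val_apply, h]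
  obtain ⟨L', r, hL'⟩ := GaloisContinuity.exists_lim_of_forall_sub_mem_lattice hcauchy
  -- `p^k` is a unit of `B_dR⁺`: `L := u L'`
  obtain ⟨u, hu⟩ : ∃ u : BDeRhamPlus (integerC F) p, (p : BDeRhamPlus (integerC F) p) ^ k * u = 1 := by
    obtain ⟨v, hv⟩ := (isUnit_natCast_bDeRhamPlus (F := F) (p := p) (Fact.out : p.Prime).ne_zero).pow k
    exact ⟨↑v⁻¹, by rw [← hv, Units.mul_inv]⟩
  refine ⟨u * L', r, fun N M hM y hy => ?_⟩
  obtain ⟨a, w, haw⟩ := hL' N M hM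
  -- change of representative: `y₀ M − y ∈ p^M B⁰_max ⊆ p^N B⁰_max`
  have hsub : y₀ M - y ∈ Ideal.span {(p : bmaxZero F p)} ^ N :=
    Ideal.pow_le_pow_right (show N ≤ M by omega) (sub_mem_pow_of_evalₐ_eq le_rfl hy (hy₀ M).symm)
  obtain ⟨a', w', haw'⟩ := exists_natCast_pow_mul_algebraMap_coe_eq_of_mem_pow hsub k
  refine ⟨a + a', w + w', ?_⟩
  have e0 : algebraMap (Localization.Away (p : Ainf (p := p) F)) (BDeRhamPlus (integerC F) p)
      ((y₀ M - y : bmaxZero F p) : Localization.Away (p : Ainf (p := p) F)) =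
      algebraMap (Localization.Away (p : Ainf (p := p) F)) (BDeRhamPlus (integerC F) p) (y₀ M : Localization.Away (p : Ainf (p := p) F)) -
        algebraMap (Localization.Away (p : Ainf (p := p) F)) (BDeRhamPlus (integerC F) p) (y : Localization.Away (p : Ainf (p := p) F)) := by
    rw [← comp_val_apply, map_sub, comp_val_apply, comp_val_apply]
  rw [e0] at haw'
  simp only [map_add, map_mul, map_pow, map_natCast] at haw haw' ⊢
  linear_combination haw + haw' + (L' * hu)

set_option maxHeartbeats 3200000 in
/-- ★ **Uniqueness of the comparison modulo `Fil^k`**: two limits `L₁, L₂` as in `exists_bdR_lim_modFil` (for the same `x` and `k`,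
with any shifts) differ by an element of `ξ^k B_dR⁺`. [cite: Colmez1998Annals, §III.2] [cite: FontaineAsterisque223III, Exp. II §1.5.3] -/
theorem sub_mem_span_xiBdR_pow_of_bdR_lim_modFil {x : BmaxPlus F p} {k : ℕ} {L₁ L₂ : BDeRhamPlus (integerC F) p} {r₁ r₂ : ℕ}
    (h₁ : ∀ N M : ℕ, N + r₁ ≤ M → ∀ y : bmaxZero F p,
      AdicCompletion.evalₐ (Ideal.span {(p : bmaxZero F p)}) M x = Ideal.Quotient.mk _ y →
      ∃ (a : Ainf (p := p) F) (w : BDeRhamPlus (integerC F) p),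
        (p : BDeRhamPlus (integerC F) p) ^ k *
            (L₁ - algebraMap (Localization.Away (p : Ainf (p := p) F)) (BDeRhamPlus (integerC F) p)
              (y : Localization.Away (p : Ainf (p := p) F))) =
          ainfToBdR ((p : Ainf (p := p) F) ^ N * a) + xiBdR ^ k * w)
    (h₂ : ∀ N M : ℕ, N + r₂ ≤ M → ∀ y : bmaxZero F p,
      AdicCompletion.evalₐ (Ideal.span {(p : bmaxZero F p)}) M x = Ideal.Quotient.mk _ y →
      ∃ (a : Ainf (p := p) F) (w : BDeRhamPlus (integerC F) p),
        (p : BDeRhamPlus (integerC F) p) ^ k *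
            (L₂ - algebraMap (Localization.Away (p : Ainf (p := p) F)) (BDeRhamPlus (integerC F) p)
              (y : Localization.Away (p : Ainf (p := p) F))) =
          ainfToBdR ((p : Ainf (p := p) F) ^ N * a) + xiBdR ^ k * w) :
    L₁ - L₂ ∈ Ideal.span {(xiBdR : BDeRhamPlus (integerC F) p) ^ k} := by
  -- `p^k (L₁ − L₂) ∈ Λ(N, k)` for all `N`
  have hmem : (p : BDeRhamPlus (integerC F) p) ^ k * (L₁ - L₂) ∈ Ideal.span {(xiBdR : BDeRhamPlus (integerC F) p) ^ k} := by
    refine GaloisContinuity.mem_span_xiBdR_pow_of_forall_lattice fun N => ?_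
    obtain ⟨y, hy⟩ := Ideal.Quotient.mk_surjective (AdicCompletion.evalₐ (Ideal.span {(p : bmaxZero F p)}) (N + r₁ + r₂) x)
    obtain ⟨a₁, w₁, e₁⟩ := h₁ N (N + r₁ + r₂) (by omega) y hy.symm
    obtain ⟨a₂, w₂, e₂⟩ := h₂ N (N + r₁ + r₂) (by omega) y hy.symm
    refine ⟨a₁ - a₂, w₁ - w₂, ?_⟩
    simp only [map_sub, map_mul, map_pow, map_natCast] at e₁ e₂ ⊢
    linear_combination e₁ - e₂
  -- cancel the unit `p^k`
  obtain ⟨v, hv⟩ := (isUnit_natCast_bDeRhamPlus (F := F) (p := p) (Fact.out : p.Prime).ne_zero).pow k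
  rw [← hv] at hmem
  exact (Ideal.unit_mul_mem_iff_mem _ v.isUnit).1 hmem

set_option maxHeartbeats 3200000 in
omit [CharZero F] in
/-- **Compatibility in `k`**: a limit modulo `Fil^{k'}` is a limit modulo `Fil^k` for `k ≤ k'` (shift enlarged by `k' − k`).
[cite: FontaineAsterisque223III, Exp. II §1.5.3] -/
theorem bdR_lim_modFil_of_le {x : BmaxPlus F p} {k k' : ℕ} (hkk' : k ≤ k') {L : BDeRhamPlus (integerC F) p} {r : ℕ}
    (h : ∀ N M : ℕ, N + r ≤ M → ∀ y : bmaxZero F p,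
      AdicCompletion.evalₐ (Ideal.span {(p : bmaxZero F p)}) M x = Ideal.Quotient.mk _ y →
      ∃ (a : Ainf (p := p) F) (w : BDeRhamPlus (integerC F) p),
        (p : BDeRhamPlus (integerC F) p) ^ k' *
            (L - algebraMap (Localization.Away (p : Ainf (p := p) F)) (BDeRhamPlus (integerC F) p)
              (y : Localization.Away (p : Ainf (p := p) F))) =
          ainfToBdR ((p : Ainf (p := p) F) ^ N * a) + xiBdR ^ k' * w) :
    ∀ N M : ℕ, N + (r + (k' - k)) ≤ M → ∀ y : bmaxZero F p,
      AdicCompletion.evalₐ (Ideal.span {(p : bmaxZero F p)}) M x = Ideal.Quotient.mk _ y →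
      ∃ (a : Ainf (p := p) F) (w : BDeRhamPlus (integerC F) p),
        (p : BDeRhamPlus (integerC F) p) ^ k *
            (L - algebraMap (Localization.Away (p : Ainf (p := p) F)) (BDeRhamPlus (integerC F) p)
              (y : Localization.Away (p : Ainf (p := p) F))) =
          ainfToBdR ((p : Ainf (p := p) F) ^ N * a) + xiBdR ^ k * w := by
  intro N M hM y hy
  obtain ⟨j, rfl⟩ := Nat.exists_eq_add_of_le hkk'
  -- apply `h` at lattice level `N + j` and cancel `p^j`
  obtain ⟨a, w, e⟩ := h (N + j) M (by omega) y hy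
  obtain ⟨v, hv⟩ := (isUnit_natCast_bDeRhamPlus (F := F) (p := p) (Fact.out : p.Prime).ne_zero).pow j
  set vi : BDeRhamPlus (integerC F) p := ((v⁻¹ : (BDeRhamPlus (integerC F) p)ˣ) : BDeRhamPlus (integerC F) p) with hvi
  have hvinv : (p : BDeRhamPlus (integerC F) p) ^ j * vi = 1 := by rw [hvi, ← hv, Units.mul_inv]
  refine ⟨a, vi * xiBdR ^ j * w, ?_⟩
  have e2 : (v : BDeRhamPlus (integerC F) p) * ((p : BDeRhamPlus (integerC F) p) ^ k *
      (L - algebraMap (Localization.Away (p : Ainf (p := p) F)) (BDeRhamPlus (integerC F) p) (y : Localization.Away (p : Ainf (p := p) F)))) =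
      (v : BDeRhamPlus (integerC F) p) * (ainfToBdR ((p : Ainf (p := p) F) ^ N * a) + xiBdR ^ k * (vi * xiBdR ^ j * w)) := by
    rw [hv, ← mul_assoc, ← pow_add, add_comm j k, e]
    simp only [map_mul, map_pow, map_natCast, pow_add]
    linear_combination (-(xiBdR ^ k * xiBdR ^ j * w)) * hvinv
  exact (Units.mul_right_inj v).1 e2

end Literature.NumberTheory.PAdicHodge

end
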